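import Literature.Analysis.SpecialFunctions.CoffeyCsordas2013.Derivatives
import HarnessLib

/-!
# Coffey–Csordas (2013), 2.5: rational enclosures of the head terms `a_n⁽ᵏ⁾(0)`, `n ≤ 4`

Source: M. W. Coffey and G. Csordas, *On the log-concavity of a Jacobi theta function*, Math. Comp. **82**
(2013), no. 284, 2265–2272, doi:10.1090/S0025-5718-2013-02681-6 [CoffeyCsordas2013] — p. 2265 (1.1)–(1.2) (the
function `Φ`), p. 2269 (their statement 2.5 = (2.19) for every `n ≥ 1`); restated verbatim as Open Problem 4.13 of
G. Csordas, *Fourier transforms of positive definite kernels and the Riemann ξ-function*, CMFT **15** (2015),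
arXiv:1309.0055 [Csordas2015].  PRIMARY READ (AMS open PDF, pp. 2265 and 2269) by the producing system, 2026-08-18.

This module (§§5–6 of the bundle file).  HEAD (`n + 1 ≤ 4`): `T_eq_ev : T k n = B(π)·(e^{−π})^{(n+1)²}` with
`B = ev (blist (n+1) k)` an explicit INTEGER polynomial in `π` (coefficient lists by structural recursion `plist`/`blist`,
correctness `p_eq_ev`, `bracket_eq`); `head_bounds k : headLoQ k ≤ Σ_{n<4} T k n ≤ headHiQ k`, where the rational
enclosures use Mathlib's 20-digit enclosure of `π` (`Real.pi_gt_d20`, `Real.pi_lt_d20`; split-sign evaluation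
`loB_le`, `ev_le_hiB`) and an enclosure `eLo ≤ e^{−π} ≤ eHi` of width `1.7·10⁻¹⁸` (`eLo_le_exp_neg_pi`, `exp_neg_pi_le`,
from `Real.exp_bound`: degree-17 Taylor polynomial at `−π/4`, fourth power); the four facts `233 380 000 ≤ headLoQ 8`,
`335 800 000 000 ≤ headLoQ 10`, `−1 ≤ headLoQ 9`, `headHiQ 9 ≤ 1` are exact rational computations evaluated by the
KERNEL (`decide +kernel`; standard axioms, no compiler trust).

Modules: `Literature.Analysis.SpecialFunctions.CoffeyCsordas2013.Derivatives` (§§1–4: `a`, `Φ`, `S`, `AllDerivativesLogConcave`; closed form of all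
derivatives of the summands, the summable majorant, termwise differentiation on `(−1,1)`:
`iteratedDeriv_zero_eq k : iteratedDeriv k Φ 0 = ∑' n, T k n`), `.Enclosures` (§§5–6: the head `n+1 ≤ 4` as integer
polynomials in `π` times powers of `e^{−π}`, 20-digit rational enclosures, four `decide +kernel` evaluations),
`.Sign` (§§7–8: the tail bound, `233 377 300 ≤ Φ⁽⁸⁾(0)`, `3.34·10¹¹ ≤ Φ⁽¹⁰⁾(0)`, `|Φ⁽⁹⁾(0)| ≤ 2 000 001`,
`S_nine_zero_neg : S 9 0 < 0`, `allDerivativesLogConcave_false`).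

Provenance: refutations bundle `papers/_cross/refutations` (H21 seat pub-refute-2, 2026-08-18), package module
`Refutations.CoffeyCsordas2013 (§§5–6)`, moved into the tree under the Lean-in-tree rule (human 2026-08-18); the witness
was found by the bundle's numerics (`numerics/coffey_csordas2013/`, three independent high-precision checkers agree:
`Φ⁽⁸⁾(0) = 2.3338698091…·10⁸`, `Φ⁽¹⁰⁾(0) = 3.3582019884…·10¹¹`, `|Φ⁽⁹⁾(0)| ≤ 3.1·10⁻³⁴`, `S₉(0) ≤ −7.8376·10¹⁹`).
Renamed from the bundle: `Conjecture25 ↦ AllDerivativesLogConcave`, `conjecture25_false ↦ allDerivativesLogConcave_false`.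
-/

set_option autoImplicit false

open Real Set Filter Topology

namespace Literature.Analysis.SpecialFunctions.CoffeyCsordas2013

noncomputable section

/-! ## 5. Exact bookkeeping: `p (s·x) k m` as an integer polynomial in `x`

The numbers `T k n` are `B(π) · e^{−π (n+1)²}` with `B` an explicit polynomial with integer
coefficients.  We compute the coefficient lists by structural recursion (so that the kernel can
evaluate them with `decide`) and bound `B(π)` from the 20-digit enclosure of `π` in Mathlib. -/

/-- `ev l x i = ∑_j l[j] · x^(i+j)`. [folklore] -/
def ev : List ℤ → ℝ → ℕ → ℝ
  | [], _, _ => 0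
  | b :: l, x, i => (b : ℝ) * x ^ i + ev l x (i + 1)

/-- Coefficientwise sum of two coefficient lists. [folklore] -/
def addL : List ℤ → List ℤ → List ℤ
  | [], l => l
  | a :: l, [] => a :: l
  | a :: l₁, b :: l₂ => (a + b) :: addL l₁ l₂

/-- Scalar multiple of a coefficient list. [folklore] -/
def smulL (c : ℤ) : List ℤ → List ℤ
  | [] => []
  | a :: l => (c * a) :: smulL c l

/-- Auxiliary lemma: `: ∀ (l₁ l₂ : List ℤ) (x : ℝ) (i : ℕ), ev (addL l₁ l₂) x i = ev l₁ x i + ev l₂ x i`. [folklore] -/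
theorem ev_addL : ∀ (l₁ l₂ : List ℤ) (x : ℝ) (i : ℕ),
    ev (addL l₁ l₂) x i = ev l₁ x i + ev l₂ x i
  | [], l, x, i => by simp [addL, ev]
  | a :: l, [], x, i => by simp [addL, ev]
  | a :: l₁, b :: l₂, x, i => by
    simp only [addL, ev, ev_addL l₁ l₂]; push_cast; ring

/-- Auxiliary lemma: `(c : ℤ) : ∀ (l : List ℤ) (x : ℝ) (i : ℕ), ev (smulL c l) x i = c * ev l x i`. [folklore] -/
theorem ev_smulL (c : ℤ) : ∀ (l : List ℤ) (x : ℝ) (i : ℕ), ev (smulL c l) x i = c * ev l x i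
  | [], x, i => by simp [smulL, ev]
  | a :: l, x, i => by simp only [smulL, ev, ev_smulL c l]; push_cast; ring

/-- Auxiliary lemma: `: ∀ (l : List ℤ) (x : ℝ) (i : ℕ), ev l x (i + 1) = x * ev l x i`. [folklore] -/
theorem ev_succ : ∀ (l : List ℤ) (x : ℝ) (i : ℕ), ev l x (i + 1) = x * ev l x i
  | [], x, i => by simp [ev]
  | a :: l, x, i => by simp only [ev, ev_succ l x (i + 1)]; ring

/-- `plist s k m` = the coefficients (in `x`) of `p (s·x) k m`. [folklore] -/
def plist (s : ℤ) : ℕ → ℤ → List ℤ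
  | 0, _ => [1]
  | k + 1, m => addL (smulL m (plist s k m)) (smulL (-(4 * s)) (0 :: plist s k (m + 4)))

/-- Auxiliary lemma: `(s : ℤ) (x : ℝ) (k : ℕ) : ∀ m : ℤ, p ((s : ℝ) * x) k (m : ℝ) = ev (plist s k m) x 0`. [folklore] -/
theorem p_eq_ev (s : ℤ) (x : ℝ) (k : ℕ) : ∀ m : ℤ, p ((s : ℝ) * x) k (m : ℝ) = ev (plist s k m) x 0 := by
  induction k with
  | zero => intro m; simp [p, plist, ev]
  | succ k ih =>
    intro m
    have h1 := ih m
    have h2 := ih (m + 4)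
    push_cast at h2
    simp only [p, plist, ev_addL, ev_smulL, ev, h1, h2, ev_succ]
    push_cast; ring

/-- `blist N k` = the coefficients (in `π`) of `2π²N⁴·p (πN²) k 9 − 3πN²·p (πN²) k 5`. [folklore] -/
def blist (N k : ℕ) : List ℤ :=
  addL (smulL (2 * (N : ℤ) ^ 4) (0 :: 0 :: plist ((N : ℤ) ^ 2) k 9))
    (smulL (-(3 * (N : ℤ) ^ 2)) (0 :: plist ((N : ℤ) ^ 2) k 5))

/-- Auxiliary lemma: `(N k : ℕ) : 2 * π ^ 2 * (N : ℝ) ^ 4 * p (π * (N : ℝ) ^ 2) k 9 - 3 * π * (N : ℝ) ^ 2 * p (π * (N : ℝ) ^ 2) k 5 = ev (blist N k) π 0`. [folklore] -/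
theorem bracket_eq (N k : ℕ) :
    2 * π ^ 2 * (N : ℝ) ^ 4 * p (π * (N : ℝ) ^ 2) k 9 - 3 * π * (N : ℝ) ^ 2 * p (π * (N : ℝ) ^ 2) k 5
      = ev (blist N k) π 0 := by
  have h9 := p_eq_ev ((N : ℤ) ^ 2) π k 9
  have h5 := p_eq_ev ((N : ℤ) ^ 2) π k 5
  push_cast at h9 h5
  rw [mul_comm ((N : ℝ) ^ 2) π] at h9 h5
  simp only [blist, ev_addL, ev_smulL, ev, ev_succ, h9, h5]
  push_cast; ring

/-- Auxiliary lemma: `(k n : ℕ) : T k n = ev (blist (n + 1) k) π 0 * exp (-π) ^ ((n + 1) ^ 2)`. [folklore] -/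
theorem T_eq_ev (k n : ℕ) :
    T k n = ev (blist (n + 1) k) π 0 * exp (-π) ^ ((n + 1) ^ 2) := by
  rw [T_eq, ← Real.exp_nat_mul, ← bracket_eq]
  push_cast
  congr 2
  ring

/-! ## 6. Rational enclosures -/

/-- Lower bound of `ev l x i` for `lo ≤ x ≤ hi`, `0 ≤ lo` (split by the sign of each coefficient). [folklore] -/
def loB : List ℤ → ℚ → ℚ → ℕ → ℚ
  | [], _, _, _ => 0
  | b :: l, u, v, i => (if 0 ≤ b then (b : ℚ) * u ^ i else (b : ℚ) * v ^ i) + loB l u v (i + 1)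

/-- Upper bound of `ev l x i` for `lo ≤ x ≤ hi`, `0 ≤ lo`. [folklore] -/
def hiB : List ℤ → ℚ → ℚ → ℕ → ℚ
  | [], _, _, _ => 0
  | b :: l, u, v, i => (if 0 ≤ b then (b : ℚ) * v ^ i else (b : ℚ) * u ^ i) + hiB l u v (i + 1)

/-- Auxiliary lemma: `(lo hi : ℚ) (x : ℝ) (hlo : 0 ≤ lo) (h1 : ((lo : ℚ) : ℝ) ≤ x) (h2 : x ≤ ((hi : ℚ) : ℝ)) : ∀ (l : List ℤ) (i : ℕ), ((loB l lo hi i : ℚ) : ℝ) ≤ ev l x i`. [folklore] -/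
theorem loB_le (lo hi : ℚ) (x : ℝ) (hlo : 0 ≤ lo) (h1 : ((lo : ℚ) : ℝ) ≤ x) (h2 : x ≤ ((hi : ℚ) : ℝ)) :
    ∀ (l : List ℤ) (i : ℕ), ((loB l lo hi i : ℚ) : ℝ) ≤ ev l x i
  | [], i => by simp [loB, ev]
  | b :: l, i => by
    have ih := loB_le lo hi x hlo h1 h2 l (i + 1)
    have hlo' : (0 : ℝ) ≤ (lo : ℝ) := by exact_mod_cast hlo
    have hx : 0 ≤ x := hlo'.trans h1
    simp only [loB, ev]
    split_ifs with hb
    · push_cast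
      have : (b : ℝ) * (lo : ℝ) ^ i ≤ (b : ℝ) * x ^ i :=
        mul_le_mul_of_nonneg_left (pow_le_pow_left₀ hlo' h1 i) (by exact_mod_cast hb)
      linarith
    · push_cast
      have hb' : (b : ℝ) ≤ 0 := by exact_mod_cast (not_le.mp hb).le
      have : (b : ℝ) * (hi : ℝ) ^ i ≤ (b : ℝ) * x ^ i :=
        mul_le_mul_of_nonpos_left (pow_le_pow_left₀ hx h2 i) hb'
      linarith

/-- Auxiliary lemma: `(lo hi : ℚ) (x : ℝ) (hlo : 0 ≤ lo) (h1 : ((lo : ℚ) : ℝ) ≤ x) (h2 : x ≤ ((hi : ℚ) : ℝ)) : ∀ (l : List ℤ) (i : ℕ), ev l x i ≤ ((hiB l lo hi i : ℚ) : ℝ)`. [folklore] -/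
theorem ev_le_hiB (lo hi : ℚ) (x : ℝ) (hlo : 0 ≤ lo) (h1 : ((lo : ℚ) : ℝ) ≤ x) (h2 : x ≤ ((hi : ℚ) : ℝ)) :
    ∀ (l : List ℤ) (i : ℕ), ev l x i ≤ ((hiB l lo hi i : ℚ) : ℝ)
  | [], i => by simp [hiB, ev]
  | b :: l, i => by
    have ih := ev_le_hiB lo hi x hlo h1 h2 l (i + 1)
    have hlo' : (0 : ℝ) ≤ (lo : ℝ) := by exact_mod_cast hlo
    have hx : 0 ≤ x := hlo'.trans h1
    simp only [hiB, ev]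
    split_ifs with hb
    · push_cast
      have : (b : ℝ) * x ^ i ≤ (b : ℝ) * (hi : ℝ) ^ i :=
        mul_le_mul_of_nonneg_left (pow_le_pow_left₀ hx h2 i) (by exact_mod_cast hb)
      linarith
    · push_cast
      have hb' : (b : ℝ) ≤ 0 := by exact_mod_cast (not_le.mp hb).le
      have : (b : ℝ) * x ^ i ≤ (b : ℝ) * (lo : ℝ) ^ i :=
        mul_le_mul_of_nonpos_left (pow_le_pow_left₀ hlo' h1 i) hb'
      linarith

/-- Mathlib's 20-digit enclosure of `π` (`Real.pi_gt_d20`, `Real.pi_lt_d20`). [folklore] -/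
def piLo : ℚ := 314159265358979323846 / 100000000000000000000
/-- Auxiliary definition `piHi` `: ℚ` (see the module docstring). [folklore] -/
def piHi : ℚ := 314159265358979323847 / 100000000000000000000

/-- `piLo < π < piHi` from Mathlib's `Real.pi_gt_d20` / `Real.pi_lt_d20` (one conjunction: the two halves separately
are the tree lemmas `Literature.NumberTheory.LFunctions.piLo20_lt` / `lt_piHi20` of `WeilSharpConstants`, whose RH-side imports are not wanted here). [folklore] -/
theorem pi_mem_piLo_piHi : ((piLo : ℚ) : ℝ) < π ∧ π < ((piHi : ℚ) : ℝ) := by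
  have h := Real.pi_gt_d20
  have h' := Real.pi_lt_d20
  simp only [piLo, piHi]; push_cast
  norm_num at h h' ⊢; constructor <;> linarith

/-- Auxiliary lemma: `: (0 : ℚ) ≤ piLo`. [folklore] -/
theorem piLo_nonneg : (0 : ℚ) ≤ piLo := by norm_num [piLo]

/-- Degree-17 Taylor polynomial of `exp` and the remainder bound of `Real.exp_bound`. [folklore] -/
def texpQ (x : ℚ) : ℚ := ∑ m ∈ Finset.range 18, x ^ m / (m.factorial : ℚ)
/-- Auxiliary definition `remQ` `(x : ℚ) : ℚ` (see the module docstring). [folklore] -/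
def remQ (x : ℚ) : ℚ := |x| ^ 18 * (((18 : ℕ).succ : ℚ) / (((18 : ℕ).factorial : ℚ) * ((18 : ℕ) : ℚ)))

/-- Auxiliary lemma: `(q : ℚ) (hq : |((q : ℚ) : ℝ)| ≤ 1) : exp (q : ℝ) ≤ ((texpQ q + remQ q : ℚ) : ℝ)`. [folklore] -/
theorem exp_le_taylor (q : ℚ) (hq : |((q : ℚ) : ℝ)| ≤ 1) :
    exp (q : ℝ) ≤ ((texpQ q + remQ q : ℚ) : ℝ) := by
  have h := (abs_sub_le_iff.1 (Real.exp_bound hq (n := 18) (by norm_num))).1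
  have e : ((texpQ q + remQ q : ℚ) : ℝ) = (∑ m ∈ Finset.range 18, (q : ℝ) ^ m / (m.factorial : ℝ))
      + |(q : ℝ)| ^ 18 * (((18 : ℕ).succ : ℝ) / (((18 : ℕ).factorial : ℝ) * ((18 : ℕ) : ℝ))) := by
    simp only [texpQ, remQ]; push_cast; rfl
  rw [e]; push_cast at h ⊢; linarith

/-- Auxiliary lemma: `(q : ℚ) (hq : |((q : ℚ) : ℝ)| ≤ 1) : ((texpQ q - remQ q : ℚ) : ℝ) ≤ exp (q : ℝ)`. [folklore] -/
theorem taylor_le_exp (q : ℚ) (hq : |((q : ℚ) : ℝ)| ≤ 1) :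
    ((texpQ q - remQ q : ℚ) : ℝ) ≤ exp (q : ℝ) := by
  have h := (abs_sub_le_iff.1 (Real.exp_bound hq (n := 18) (by norm_num))).2
  have e : ((texpQ q - remQ q : ℚ) : ℝ) = (∑ m ∈ Finset.range 18, (q : ℝ) ^ m / (m.factorial : ℝ))
      - |(q : ℝ)| ^ 18 * (((18 : ℕ).succ : ℝ) / (((18 : ℕ).factorial : ℝ) * ((18 : ℕ) : ℝ))) := by
    simp only [texpQ, remQ]; push_cast; rfl
  rw [e]; push_cast at h ⊢; linarith

/-- An enclosure of `e^{−π}` of width `1.7·10⁻¹⁸` (30-decimal rationals). [folklore] -/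
def eLo : ℚ := 8642783652754449646125780671 / 200000000000000000000000000000
/-- Auxiliary definition `eHi` `: ℚ` (see the module docstring). [folklore] -/
def eHi : ℚ := 43213918263772249847523646157 / 1000000000000000000000000000000

/-- Auxiliary lemma: `: (texpQ (-(piLo / 4)) + remQ (-(piLo / 4))) ^ 4 ≤ eHi`. [folklore] -/
theorem eHi_cert : (texpQ (-(piLo / 4)) + remQ (-(piLo / 4))) ^ 4 ≤ eHi := by decide +kernel
/-- Auxiliary lemma: `: eLo ≤ (texpQ (-(piHi / 4)) - remQ (-(piHi / 4))) ^ 4`. [folklore] -/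
theorem eLo_cert : eLo ≤ (texpQ (-(piHi / 4)) - remQ (-(piHi / 4))) ^ 4 := by decide +kernel
/-- Auxiliary lemma: `: 0 ≤ texpQ (-(piHi / 4)) - remQ (-(piHi / 4))`. [folklore] -/
theorem eLo_cert₀ : 0 ≤ texpQ (-(piHi / 4)) - remQ (-(piHi / 4)) := by decide +kernel

/-- Auxiliary lemma: `: exp (-π) ≤ ((eHi : ℚ) : ℝ)`. [folklore] -/
theorem exp_neg_pi_le : exp (-π) ≤ ((eHi : ℚ) : ℝ) := by
  have h1 : exp (-π) ≤ exp (((-(piLo / 4) : ℚ) : ℝ)) ^ 4 := by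
    rw [← Real.exp_nat_mul]; apply exp_le_exp.mpr; push_cast; linarith [pi_mem_piLo_piHi.1]
  have hq : |(((-(piLo / 4)) : ℚ) : ℝ)| ≤ 1 := by
    rw [abs_le]; push_cast; constructor <;> norm_num [piLo]
  have h2 := exp_le_taylor _ hq
  have h4 : exp (((-(piLo / 4) : ℚ) : ℝ)) ^ 4 ≤ (((texpQ (-(piLo / 4)) + remQ (-(piLo / 4))) : ℚ) : ℝ) ^ 4 :=
    pow_le_pow_left₀ (exp_pos _).le h2 4
  have h5 : (((texpQ (-(piLo / 4)) + remQ (-(piLo / 4))) : ℚ) : ℝ) ^ 4 ≤ ((eHi : ℚ) : ℝ) := by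
    exact_mod_cast eHi_cert
  linarith

/-- Auxiliary lemma: `: ((eLo : ℚ) : ℝ) ≤ exp (-π)`. [folklore] -/
theorem eLo_le_exp_neg_pi : ((eLo : ℚ) : ℝ) ≤ exp (-π) := by
  have h1 : exp (((-(piHi / 4) : ℚ) : ℝ)) ^ 4 ≤ exp (-π) := by
    rw [← Real.exp_nat_mul]; apply exp_le_exp.mpr; push_cast; linarith [pi_mem_piLo_piHi.2]
  have hq : |(((-(piHi / 4)) : ℚ) : ℝ)| ≤ 1 := by
    rw [abs_le]; push_cast; constructor <;> norm_num [piHi]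
  have h2 := taylor_le_exp _ hq
  have h0 : (0 : ℝ) ≤ (((texpQ (-(piHi / 4)) - remQ (-(piHi / 4))) : ℚ) : ℝ) := by
    exact_mod_cast eLo_cert₀
  have h4 : (((texpQ (-(piHi / 4)) - remQ (-(piHi / 4))) : ℚ) : ℝ) ^ 4 ≤ exp (((-(piHi / 4) : ℚ) : ℝ)) ^ 4 :=
    pow_le_pow_left₀ h0 h2 4
  have h5 : ((eLo : ℚ) : ℝ) ≤ (((texpQ (-(piHi / 4)) - remQ (-(piHi / 4))) : ℚ) : ℝ) ^ 4 := by
    exact_mod_cast eLo_cert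
  linarith

/-- Auxiliary lemma: `: (0 : ℚ) ≤ eLo`. [folklore] -/
theorem eLo_nonneg : (0 : ℚ) ≤ eLo := by norm_num [eLo]

/-- Enclosure of one head term `T k (N-1) = B_N(π)·(e^{−π})^{N²}`. [folklore] -/
def tLoQ (N k : ℕ) : ℚ :=
  min (loB (blist N k) piLo piHi 0 * eLo ^ (N ^ 2)) (loB (blist N k) piLo piHi 0 * eHi ^ (N ^ 2))
/-- Auxiliary definition `tHiQ` `(N k : ℕ) : ℚ` (see the module docstring). [folklore] -/
def tHiQ (N k : ℕ) : ℚ :=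
  max (hiB (blist N k) piLo piHi 0 * eLo ^ (N ^ 2)) (hiB (blist N k) piLo piHi 0 * eHi ^ (N ^ 2))

/-- Auxiliary lemma: `{B e bl bh el eh : ℝ} (hB1 : bl ≤ B) (hB2 : B ≤ bh) (he1 : el ≤ e) (he2 : e ≤ eh) (hel : 0 ≤ el) : min (bl * el) (bl * eh) ≤ B * e ∧ B * e ≤ max (bh * el) (bh * eh)`. [folklore] -/
theorem mul_mem_bounds {B e bl bh el eh : ℝ} (hB1 : bl ≤ B) (hB2 : B ≤ bh) (he1 : el ≤ e)
    (he2 : e ≤ eh) (hel : 0 ≤ el) :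
    min (bl * el) (bl * eh) ≤ B * e ∧ B * e ≤ max (bh * el) (bh * eh) := by
  have he0 : 0 ≤ e := hel.trans he1
  constructor
  · have h1 : bl * e ≤ B * e := mul_le_mul_of_nonneg_right hB1 he0
    have h2 : min (bl * el) (bl * eh) ≤ bl * e := by
      rcases le_total 0 bl with hbl | hbl
      · exact (min_le_left _ _).trans (mul_le_mul_of_nonneg_left he1 hbl)
      · exact (min_le_right _ _).trans (mul_le_mul_of_nonpos_left he2 hbl)
    exact h2.trans h1
  · have h1 : B * e ≤ bh * e := mul_le_mul_of_nonneg_right hB2 he0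
    have h2 : bh * e ≤ max (bh * el) (bh * eh) := by
      rcases le_total 0 bh with hbh | hbh
      · exact (mul_le_mul_of_nonneg_left he2 hbh).trans (le_max_right _ _)
      · exact (mul_le_mul_of_nonpos_left he1 hbh).trans (le_max_left _ _)
    exact h1.trans h2

/-- Auxiliary lemma: `(k n : ℕ) : ((tLoQ (n + 1) k : ℚ) : ℝ) ≤ T k n ∧ T k n ≤ ((tHiQ (n + 1) k : ℚ) : ℝ)`. [folklore] -/
theorem T_mem_bounds (k n : ℕ) :
    ((tLoQ (n + 1) k : ℚ) : ℝ) ≤ T k n ∧ T k n ≤ ((tHiQ (n + 1) k : ℚ) : ℝ) := by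
  have hB1 := loB_le piLo piHi π piLo_nonneg pi_mem_piLo_piHi.1.le pi_mem_piLo_piHi.2.le (blist (n + 1) k) 0
  have hB2 := ev_le_hiB piLo piHi π piLo_nonneg pi_mem_piLo_piHi.1.le pi_mem_piLo_piHi.2.le (blist (n + 1) k) 0
  have hel : (0 : ℝ) ≤ ((eLo : ℚ) : ℝ) ^ ((n + 1) ^ 2) := pow_nonneg (by exact_mod_cast eLo_nonneg) _
  have he1 : ((eLo : ℚ) : ℝ) ^ ((n + 1) ^ 2) ≤ exp (-π) ^ ((n + 1) ^ 2) :=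
    pow_le_pow_left₀ (by exact_mod_cast eLo_nonneg) eLo_le_exp_neg_pi _
  have he2 : exp (-π) ^ ((n + 1) ^ 2) ≤ ((eHi : ℚ) : ℝ) ^ ((n + 1) ^ 2) :=
    pow_le_pow_left₀ (exp_pos _).le exp_neg_pi_le _
  have h := mul_mem_bounds hB1 hB2 he1 he2 hel
  rw [T_eq_ev]
  simp only [tLoQ, tHiQ]; push_cast
  exact h

/-- Enclosure of the head `∑_{n<4} T k n` (the terms `N = n+1 ≤ 4`). [folklore] -/
def headLoQ (k : ℕ) : ℚ := tLoQ 1 k + tLoQ 2 k + tLoQ 3 k + tLoQ 4 k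
/-- Auxiliary definition `headHiQ` `(k : ℕ) : ℚ` (see the module docstring). [folklore] -/
def headHiQ (k : ℕ) : ℚ := tHiQ 1 k + tHiQ 2 k + tHiQ 3 k + tHiQ 4 k

/-- Auxiliary lemma: `(k : ℕ) : ((headLoQ k : ℚ) : ℝ) ≤ ∑ n ∈ Finset.range 4, T k n ∧ ∑ n ∈ Finset.range 4, T k n ≤ ((headHiQ k : ℚ) : ℝ)`. [folklore] -/
theorem head_bounds (k : ℕ) :
    ((headLoQ k : ℚ) : ℝ) ≤ ∑ n ∈ Finset.range 4, T k n ∧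
      ∑ n ∈ Finset.range 4, T k n ≤ ((headHiQ k : ℚ) : ℝ) := by
  have h0 := T_mem_bounds k 0
  have h1 := T_mem_bounds k 1
  have h2 := T_mem_bounds k 2
  have h3 := T_mem_bounds k 3
  simp only [Finset.sum_range_succ, Finset.sum_range_zero, headLoQ, headHiQ]
  push_cast
  constructor <;> linarith [h0.1, h0.2, h1.1, h1.2, h2.1, h2.2, h3.1, h3.2]

/-- Kernel computation (exact rational arithmetic): `233 380 000 ≤ headLoQ 8`. [folklore] -/
theorem headLo_eight : (233380000 : ℚ) ≤ headLoQ 8 := by decide +kernel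
/-- Kernel computation: `335 800 000 000 ≤ headLoQ 10`. [folklore] -/
theorem headLo_ten : (335800000000 : ℚ) ≤ headLoQ 10 := by decide +kernel
/-- Kernel computation: `headHiQ 9 ≤ 1`. [folklore] -/
theorem headHi_nine : headHiQ 9 ≤ 1 := by decide +kernel
/-- Kernel computation: `−1 ≤ headLoQ 9`. [folklore] -/
theorem headLo_nine : -1 ≤ headLoQ 9 := by decide +kernel

end

end Literature.Analysis.SpecialFunctions.CoffeyCsordas2013
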